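import Summits.AtomisticToContinuum.Crystallization.Theorems.ExcessDecayLiouvilleCoarseGrainsPinEval

/-!
# Relaxed hcp reference, part T: lattice-sum tails for every layer ratio
(stub `stub_relaxedReference` of line `mtp-prestress-split-ergodic-frame`, crux `LayeredLawsSelectHcp`,
stmt-AtomisticToContinuum-9226)

The certified lattice-sum machinery of `…CoarseGrainsPinTail/PinEval` (sums
`S e c = hcpSumS e c = ∑_{v ≠ 0} (Q v + k²c²)⁻ᵉ`, cube truncations, kernel-evaluated floor sums) is stated
for layer ratios with `c² ≥ 3/5`.  The existence half of the relaxed reference needs the same bounds for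
EVERY `c > 0` (exclusion of the shapes `c < 0.78`).  This file re-runs the shell argument with a parameter
`θ ∈ (0, 3/5]`, `θ ≤ c²`: a site of sup-norm `m ≥ 4` has `Q + k²c² ≥ θ m²`, so every bound of the old files
holds with the tail multiplied by `((3/5)/θ)ᵉ`:

* `hcpSum_sdiff_cube_le_gen`: `∑_{[-K',K']³ ∖ [-K,K]³} term ≤ ((3/5)/θ)ᵉ · hcpSumTail e K`;
* summability of `S e c` for all `e ≥ 3`, `c > 0`, truncation bounds, antitonicity on `(0, ∞)`, `S e c ≥ 1`;
* the certified bounds at rational `c = p/q`: `stub_relaxedReferenceTail` (lower bound, no side condition on `c`; the registered sub-goal closing this part) and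
  `hcpSumS_le_cert_gen` (tail `((3/5)/θ)ᵉ · hcpSumTail e K`).

All `[folklore]` numerics bookkeeping; no definitions.
-/

noncomputable section

namespace Summit.AtomisticToContinuum.Crystallization.Theorems.PalmUnimodularRigidity.LayeredLawsSelectHcp

open Finset
open Summit.AtomisticToContinuum.Crystallization.Theorems.ExcessDecayLiouvilleCoarseGrains

/-! ## Shell bounds with a parameter `θ ≤ min (c², 3/5)` -/

/-- **Shell bound for the squared norm, general layer ratio**: if `max(|k|,|i|,|j|) ≥ m ≥ 4`,
`0 < θ ≤ 3/5` and `θ ≤ c²` then `Q + k²c² ≥ θ m²`. [folklore] -/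
theorem hcpSum_r_ge_gen {k i j : ℤ} {m : ℕ} (hm : 4 ≤ m)
    (hv : (m : ℤ) ≤ |k| ∨ (m : ℤ) ≤ |i| ∨ (m : ℤ) ≤ |j|) {θ c : ℝ} (hθ : 0 < θ) (hθ' : θ ≤ 3 / 5)
    (hc : θ ≤ c ^ 2) :
    θ * (m : ℝ) ^ 2 ≤ hcpSumQ (k, i, j) + (k : ℝ) ^ 2 * c ^ 2 := by
  have hm4 : (4 : ℝ) ≤ m := by exact_mod_cast hm
  have hQ := hcpSumQ_nonneg (k, i, j)
  have hk2 : 0 ≤ (k : ℝ) ^ 2 * c ^ 2 := by positivity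
  have hm2 : 0 ≤ (m : ℝ) ^ 2 := by positivity
  rcases hv with hk | hi | hj
  · have hk' : (m : ℝ) ≤ |(k : ℝ)| := by rw [← Int.cast_abs]; exact_mod_cast hk
    have hkk : (m : ℝ) ^ 2 ≤ (k : ℝ) ^ 2 := by
      calc (m : ℝ) ^ 2 ≤ |(k : ℝ)| ^ 2 := pow_le_pow_left₀ (by positivity) hk' 2
        _ = _ := sq_abs _
    have h1 : θ * (m : ℝ) ^ 2 ≤ θ * (k : ℝ) ^ 2 := mul_le_mul_of_nonneg_left hkk hθ.le
    have h2 : θ * (k : ℝ) ^ 2 ≤ c ^ 2 * (k : ℝ) ^ 2 := mul_le_mul_of_nonneg_right hc (by positivity)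
    nlinarith
  · have h := hcpSumQ_ge_of_le_abs_fst (k := k) (j := j) (by omega) hi
    have h35 : 3 / 5 * (m : ℝ) ^ 2 ≤ hcpSumQ (k, i, j) := by nlinarith
    have : θ * (m : ℝ) ^ 2 ≤ 3 / 5 * (m : ℝ) ^ 2 := mul_le_mul_of_nonneg_right hθ' hm2
    linarith
  · have h := hcpSumQ_ge_of_le_abs_snd (k := k) (i := i) (by omega) hj
    have h35 : 3 / 5 * (m : ℝ) ^ 2 ≤ hcpSumQ (k, i, j) := by nlinarith
    have : θ * (m : ℝ) ^ 2 ≤ 3 / 5 * (m : ℝ) ^ 2 := mul_le_mul_of_nonneg_right hθ' hm2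
    linarith

/-- **Shell bound for the terms, general layer ratio**: `term ≤ ((3/5)/θ)ᵉ · ((3/5) m²)⁻ᵉ`. [folklore] -/
theorem hcpSumTerm_le_of_shell_gen {e : ℕ} {θ c : ℝ} (hθ : 0 < θ) (hθ' : θ ≤ 3 / 5) (hc : θ ≤ c ^ 2)
    {m : ℕ} (hm : 4 ≤ m) {v : ℤ × ℤ × ℤ} (hv : (m : ℤ) ≤ |v.1| ∨ (m : ℤ) ≤ |v.2.1| ∨ (m : ℤ) ≤ |v.2.2|) :
    hcpSumTerm e c v ≤ ((3 / 5) / θ) ^ e * ((3 / 5 * (m : ℝ) ^ 2)⁻¹) ^ e := by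
  obtain ⟨k, i, j⟩ := v
  have hr := hcpSum_r_ge_gen hm hv hθ hθ' hc
  have hm0 : (0 : ℝ) < (m : ℝ) ^ 2 := by
    have : (4 : ℝ) ≤ m := by exact_mod_cast hm
    positivity
  have hθm : 0 < θ * (m : ℝ) ^ 2 := mul_pos hθ hm0
  have heq : ((3 / 5) / θ) ^ e * ((3 / 5 * (m : ℝ) ^ 2)⁻¹) ^ e = ((θ * (m : ℝ) ^ 2)⁻¹) ^ e := by
    rw [← mul_pow]
    congr 1
    field_simp
  rw [heq]
  unfold hcpSumTerm
  split_ifs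
  · positivity
  · have hQ := hcpSumQ_nonneg (k, i, j)
    have h0 : 0 ≤ (hcpSumQ (k, i, j) + ((k, i, j).1 : ℝ) ^ 2 * c ^ 2)⁻¹ := by
      rw [inv_nonneg]; positivity
    exact pow_le_pow_left₀ h0 (inv_anti₀ hθm hr) e

/-- **Sum over one shell, general layer ratio**: for `m ≥ 4`,
`∑_{shell m} term ≤ ((3/5)/θ)ᵉ (24m²+2)((3/5)m²)⁻ᵉ`. [folklore] -/
theorem hcpSum_sum_shell_le_gen {e : ℕ} {θ c : ℝ} (hθ : 0 < θ) (hθ' : θ ≤ 3 / 5) (hc : θ ≤ c ^ 2)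
    {m : ℕ} (hm : 4 ≤ m) :
    ∑ v ∈ hcpSumCube m \ hcpSumCube (m - 1), hcpSumTerm e c v ≤
      ((3 / 5) / θ) ^ e * ((24 * (m : ℝ) ^ 2 + 2) * ((3 / 5 * (m : ℝ) ^ 2)⁻¹) ^ e) := by
  have hbound : ∀ v ∈ hcpSumCube m \ hcpSumCube (m - 1),
      hcpSumTerm e c v ≤ ((3 / 5) / θ) ^ e * ((3 / 5 * (m : ℝ) ^ 2)⁻¹) ^ e := by
    intro v hv
    rw [Finset.mem_sdiff, hcpSum_not_mem_hcpSumCube] at hv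
    apply hcpSumTerm_le_of_shell_gen hθ hθ' hc hm
    have h1 : ((m - 1 : ℕ) : ℤ) + 1 = m := by omega
    rw [h1] at hv
    exact hv.2
  calc ∑ v ∈ hcpSumCube m \ hcpSumCube (m - 1), hcpSumTerm e c v
      ≤ ∑ _v ∈ hcpSumCube m \ hcpSumCube (m - 1), ((3 / 5) / θ) ^ e * ((3 / 5 * (m : ℝ) ^ 2)⁻¹) ^ e :=
        Finset.sum_le_sum hbound
    _ = _ := by
        rw [Finset.sum_const, nsmul_eq_mul, hcpSum_card_shell (by omega)]
        ring

/-- **Cube differences are below the scaled tail bound**: for `e ≥ 3`, `K ≥ 4`, `0 < θ ≤ 3/5`,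
`θ ≤ c²` and every `K' ≥ K`, `∑_{[-K',K']³ ∖ [-K,K]³} term ≤ ((3/5)/θ)ᵉ · T(e,K)`. [folklore] -/
theorem hcpSum_sdiff_cube_le_gen {e : ℕ} (he : 3 ≤ e) {θ c : ℝ} (hθ : 0 < θ) (hθ' : θ ≤ 3 / 5)
    (hc : θ ≤ c ^ 2) {K K' : ℕ} (hK : 4 ≤ K) (h : K ≤ K') :
    ∑ v ∈ hcpSumCube K' \ hcpSumCube K, hcpSumTerm e c v ≤ ((3 / 5) / θ) ^ e * hcpSumTail e K := by
  have hfac : 0 ≤ ((3 / 5) / θ) ^ e := by positivity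
  -- first the telescopable form
  have main : ∑ v ∈ hcpSumCube K' \ hcpSumCube K, hcpSumTerm e c v ≤
      ((3 / 5) / θ) ^ e * (25 * (5 / 3 : ℝ) ^ e / ((K : ℝ) + 1) ^ (2 * e - 6) *
        ∑ m ∈ Finset.Ioc K K', ((m : ℝ) ^ 4)⁻¹) := by
    induction K', h using Nat.le_induction with
    | base => simp
    | succ K' hKK' ih =>
      have hsplit : hcpSumCube (K' + 1) \ hcpSumCube K =
          (hcpSumCube (K' + 1) \ hcpSumCube K') ∪ (hcpSumCube K' \ hcpSumCube K) :=
        (Finset.sdiff_union_sdiff_cancel (hcpSumCube_mono (Nat.le_succ K')) (hcpSumCube_mono hKK')).symm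
      have hdisj : Disjoint (hcpSumCube (K' + 1) \ hcpSumCube K') (hcpSumCube K' \ hcpSumCube K) :=
        Finset.disjoint_left.2 fun v h1 h2 => (Finset.mem_sdiff.1 h1).2 (Finset.mem_sdiff.1 h2).1
      rw [hsplit, Finset.sum_union hdisj, Finset.sum_Ioc_succ_top hKK', mul_add, mul_add]
      have hshell := hcpSum_sum_shell_le_gen (e := e) hθ hθ' hc (m := K' + 1) (by omega)
      rw [show K' + 1 - 1 = K' from rfl] at hshell
      have hsb := hcpSum_shell_bound_le (e := e) (K := K) (m := K' + 1) he (by omega) (by omega)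
      have hsb' := mul_le_mul_of_nonneg_left hsb hfac
      push_cast at hshell hsb' ⊢
      have : ((3 / 5) / θ) ^ e * (25 * (5 / 3 : ℝ) ^ e / ((K : ℝ) + 1) ^ (2 * e - 6) * (((K' : ℝ) + 1) ^ 4)⁻¹) =
          ((3 / 5) / θ) ^ e * (25 * (5 / 3 : ℝ) ^ e / ((K : ℝ) + 1) ^ (2 * e - 6)) * (((K' : ℝ) + 1) ^ 4)⁻¹ := by
        ring
      linarith
  refine main.trans ?_
  rw [← mul_assoc]
  have htel := hcpSum_sum_Ioc_inv_pow_four_le (K := K) (K' := K') (by omega) h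
  have hpos : 0 ≤ ((3 / 5) / θ) ^ e * (25 * (5 / 3 : ℝ) ^ e / ((K : ℝ) + 1) ^ (2 * e - 6)) := by positivity
  have hK3 : (3 : ℝ) ≤ K := by exact_mod_cast (show 3 ≤ K by omega)
  have hK'3 : (3 : ℝ) ≤ K' := by exact_mod_cast (show 3 ≤ K' by omega)
  have hdrop : 1 / 3 * (1 / ((K : ℝ) * (K - 1) * (K - 2)) - 1 / ((K' : ℝ) * (K' - 1) * (K' - 2))) ≤
      1 / 3 / ((K : ℝ) * (K - 1) * (K - 2)) := by
    have : 0 ≤ 1 / ((K' : ℝ) * (K' - 1) * (K' - 2)) := by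
      have : (0:ℝ) < K' - 2 := by linarith
      have : (0:ℝ) < K' - 1 := by linarith
      positivity
    have e1 : (1:ℝ) / 3 / ((K : ℝ) * (K - 1) * (K - 2)) = 1 / 3 * (1 / ((K : ℝ) * (K - 1) * (K - 2))) := by
      ring
    linarith
  calc ((3 / 5) / θ) ^ e * (25 * (5 / 3 : ℝ) ^ e / ((K : ℝ) + 1) ^ (2 * e - 6)) *
        ∑ m ∈ Finset.Ioc K K', ((m : ℝ) ^ 4)⁻¹
      ≤ ((3 / 5) / θ) ^ e * (25 * (5 / 3 : ℝ) ^ e / ((K : ℝ) + 1) ^ (2 * e - 6)) *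
        (1 / 3 / ((K : ℝ) * (K - 1) * (K - 2))) :=
        mul_le_mul_of_nonneg_left (htel.trans hdrop) hpos
    _ = ((3 / 5) / θ) ^ e * hcpSumTail e K := by unfold hcpSumTail; ring

/-- **Finite sums are bounded by cube + scaled tail** (general layer ratio). [folklore] -/
theorem hcpSum_sum_le_cube_add_tail_gen {e : ℕ} (he : 3 ≤ e) {θ c : ℝ} (hθ : 0 < θ) (hθ' : θ ≤ 3 / 5)
    (hc : θ ≤ c ^ 2) {K : ℕ} (hK : 4 ≤ K) (s : Finset (ℤ × ℤ × ℤ)) :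
    ∑ v ∈ s, hcpSumTerm e c v ≤ ∑ v ∈ hcpSumCube K, hcpSumTerm e c v + ((3 / 5) / θ) ^ e * hcpSumTail e K := by
  obtain ⟨K', hKK', hs⟩ := hcpSum_exists_subset_hcpSumCube s K
  calc ∑ v ∈ s, hcpSumTerm e c v ≤ ∑ v ∈ hcpSumCube K', hcpSumTerm e c v :=
        Finset.sum_le_sum_of_subset_of_nonneg hs fun v _ _ => hcpSumTerm_nonneg e c v
    _ = ∑ v ∈ hcpSumCube K' \ hcpSumCube K, hcpSumTerm e c v + ∑ v ∈ hcpSumCube K, hcpSumTerm e c v :=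
        (Finset.sum_sdiff (hcpSumCube_mono hKK')).symm
    _ ≤ ((3 / 5) / θ) ^ e * hcpSumTail e K + ∑ v ∈ hcpSumCube K, hcpSumTerm e c v := by
        have := hcpSum_sdiff_cube_le_gen he hθ hθ' hc hK hKK'
        linarith
    _ = _ := add_comm _ _

/-! ## Consequences for every layer ratio `c > 0` -/

/-- For `c > 0` the parameter `θ = min (c², 3/5)` is admissible. [folklore] -/
theorem hcpSum_theta_aux {c : ℝ} (hc : 0 < c) :
    0 < min (c ^ 2) (3 / 5) ∧ min (c ^ 2) (3 / 5) ≤ 3 / 5 ∧ min (c ^ 2) (3 / 5) ≤ c ^ 2 :=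
  ⟨lt_min (by positivity) (by norm_num), min_le_right _ _, min_le_left _ _⟩

/-- **Summability** of the lattice sums `S e c` for `e ≥ 3` and EVERY `c > 0`. [folklore] -/
theorem hcpSumTerm_summable_gen {e : ℕ} (he : 3 ≤ e) {c : ℝ} (hc : 0 < c) : Summable (hcpSumTerm e c) := by
  obtain ⟨h1, h2, h3⟩ := hcpSum_theta_aux hc
  exact summable_of_sum_le (fun v => hcpSumTerm_nonneg e c v)
    (hcpSum_sum_le_cube_add_tail_gen he h1 h2 h3 (le_refl 4))

/-- **Upper bound**: `S e c ≤ ∑_{[-K,K]³} term + ((3/5)/θ)ᵉ T(e,K)`. [folklore] -/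
theorem hcpSumS_le_cube_add_tail_gen {e : ℕ} (he : 3 ≤ e) {θ c : ℝ} (hθ : 0 < θ) (hθ' : θ ≤ 3 / 5)
    (hc : θ ≤ c ^ 2) {K : ℕ} (hK : 4 ≤ K) :
    hcpSumS e c ≤ ∑ v ∈ hcpSumCube K, hcpSumTerm e c v + ((3 / 5) / θ) ^ e * hcpSumTail e K :=
  Real.tsum_le_of_sum_le (fun v => hcpSumTerm_nonneg e c v) (hcpSum_sum_le_cube_add_tail_gen he hθ hθ' hc hK)

/-- **Lower bound by any finite partial sum** (every `c > 0`). [folklore] -/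
theorem hcpSum_sum_le_hcpSumS_gen {e : ℕ} (he : 3 ≤ e) {c : ℝ} (hc : 0 < c) (s : Finset (ℤ × ℤ × ℤ)) :
    ∑ v ∈ s, hcpSumTerm e c v ≤ hcpSumS e c :=
  (hcpSumTerm_summable_gen he hc).sum_le_tsum s fun v _ => hcpSumTerm_nonneg e c v

/-- **Monotonicity on `(0, ∞)`**: `S e` is antitone in `c > 0`. [folklore] -/
theorem hcpSumS_antitone_gen {e : ℕ} (he : 3 ≤ e) {c₁ c₂ : ℝ} (h₁ : 0 < c₁) (h₁₂ : c₁ ≤ c₂) :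
    hcpSumS e c₂ ≤ hcpSumS e c₁ :=
  (hcpSumTerm_summable_gen he (h₁.trans_le h₁₂)).tsum_le_tsum (hcpSumTerm_antitone h₁ h₁₂)
    (hcpSumTerm_summable_gen he h₁)

/-- **Positivity**: `S e c ≥ 1` for every `c > 0` (the term at `v = (0,1,0)` equals `1`). [folklore] -/
theorem hcpSum_one_le_hcpSumS_gen {e : ℕ} (he : 3 ≤ e) {c : ℝ} (hc : 0 < c) : 1 ≤ hcpSumS e c := by
  have h1 : hcpSumTerm e c ((0 : ℤ), (1 : ℤ), (0 : ℤ)) = 1 := by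
    unfold hcpSumTerm
    rw [if_neg (by decide), hcpSumQ_even (show Even (0 : ℤ) from ⟨0, rfl⟩)]
    simp
  rw [← h1]
  exact (hcpSumTerm_summable_gen he hc).le_tsum _ fun v _ => hcpSumTerm_nonneg e c v

/-! ## Certified bounds at rational layer ratios, every `c > 0` -/

/-- **Certified upper bound** (general layer ratio): for `0 < θ ≤ 3/5`, `θ ≤ (p/q)²`,
`S e (p/q) ≤ (3q²)ᵉ (FS + (2K+1)³)/M + ((3/5)/θ)ᵉ T(e,K)`. [folklore] -/
theorem hcpSumS_le_cert_gen : ∀ {e : ℕ}, 3 ≤ e → ∀ {p q : ℕ}, 0 < p → 0 < q →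
    ∀ {θ : ℝ}, 0 < θ → θ ≤ 3 / 5 → θ ≤ ((p : ℝ) / q) ^ 2 → ∀ {K : ℕ}, 4 ≤ K → ∀ {M : ℕ}, 0 < M →
    hcpSumS e ((p : ℝ) / q) ≤
      (3 * (q : ℝ) ^ 2) ^ e * ((hcpSumFloorSum p q K e M : ℝ) + (2 * K + 1) ^ 3) / M +
        ((3 / 5) / θ) ^ e * hcpSumTail e K := by
  intro e he p q hp hq θ hθ hθ' hc K hK M hM
  refine le_trans (hcpSumS_le_cube_add_tail_gen he hθ hθ' hc hK) ?_
  rw [hcpSum_sum_hcpSumCube_hcpSumTerm_eq p hq]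
  refine add_le_add_left ?_ _
  rw [mul_div_assoc]
  refine mul_le_mul_of_nonneg_left ?_ (by positivity)
  rw [le_div_iff₀ (by exact_mod_cast hM)]
  have := hcpSum_le_hcpSumFloorSum_add hp hq K e M
  linarith

/-- **Certified lower bound at a rational layer ratio, no side condition on `c = p/q > 0`**
(registered sub-goal `stub_relaxedReferenceTail` of stmt-AtomisticToContinuum-9226, the closing theorem of
this part): `(3q²)ᵉ · FS / M ≤ S e (p/q)` for the kernel-evaluable floor sum `FS = hcpSumFloorSum p q K e M`.
[folklore] -/
theorem stub_relaxedReferenceTail : ∀ {e : ℕ}, 3 ≤ e → ∀ {p q : ℕ}, 0 < p → 0 < q → ∀ (K : ℕ) {M : ℕ}, 0 < M → (3 * (q : ℝ) ^ 2) ^ e * (Summit.AtomisticToContinuum.Crystallization.Theorems.ExcessDecayLiouvilleCoarseGrains.hcpSumFloorSum p q K e M : ℝ) / M ≤ Summit.AtomisticToContinuum.Crystallization.Theorems.ExcessDecayLiouvilleCoarseGrains.hcpSumS e ((p : ℝ) / q) := by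
  intro e he p q hp hq K M hM
  have hc : (0 : ℝ) < (p : ℝ) / q := by positivity
  refine le_trans ?_ (hcpSum_sum_le_hcpSumS_gen he hc (hcpSumCube K))
  rw [hcpSum_sum_hcpSumCube_hcpSumTerm_eq p hq, mul_div_assoc]
  refine mul_le_mul_of_nonneg_left ?_ (by positivity)
  rw [div_le_iff₀ (by exact_mod_cast hM)]
  have := hcpSumFloorSum_le hp hq K e M
  linarith

end Summit.AtomisticToContinuum.Crystallization.Theorems.PalmUnimodularRigidity.LayeredLawsSelectHcp

end
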